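import Literature.NumberTheory.Automorphic.UnitaryGroupHeisenbergBorelConj
import Literature.NumberTheory.Automorphic.AdelicMatrixPoisson
import HarnessLib

/-!
# The three-factor normal form of a conjugated Heisenberg element on `GL₃(𝔸_E)`:
# `π((bk)⁻¹ u (bk)) = (exp(a₁·Ad(κ⁻¹)E₀₂) exp(a₂·Ad(κ⁻¹)E₀₁) exp(a₃·Ad(κ⁻¹)E₁₂), 1) · (1, κ_f⁻¹ h κ_f)`
(Rogawski, *Automorphic Representations of Unitary Groups in Three Variables* (1990), §1.10, §2.2; Borel–Jacquet (1979), §4.1)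

Topic `NumberTheory/Automorphic`; namespace `Literature.NumberTheory.Automorphic.UnitaryGroup`.  THEOREMS ONLY (kernel lane): no `def`,
no named fact, no instance, no notation, no `sorry`.  Row H5b (FILE 2A, the ALGEBRA of the dress) of the T1-qs sub-line of `F0_T1InnerFormTraceIdentity`
(cell hodgecm-mathlib, F0P3a RULING #100 (a); H5 trunk A-p09 (g20), HEAD ★ `forall_norm_sub_conj_le_of_threeFactor` of `UnitaryGroupTruncatedKernelOscillation`,
whose hypothesis `hgeom` this row instantiates).

Everything is read on `GL₃(𝔸_E)` through `π := adelicVal F E c 3 _`; `ι∞ := GLn.ofInfinite 3 E`, `ιf := GLn.ofFinite 3 E`, the archimedean part of an adèle is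
read in `mixedSpace E` through ★ `archHom E : 𝔸_E →+* mixedSpace E` (`x ↦ ringEquiv_mixedSpace x_∞`, `AdelicMatrixPoisson`), `E_ij := Matrix.single i j 1`.
* §1 `one_add_single_three_mul` — the `3 × 3` identity `(1 + aE₀₂)(1 + bE₀₁)(1 + dE₁₂) = 1 + bE₀₁ + dE₁₂ + (a + bd)E₀₂` (any semiring);
  `single_mul_single_self_eq_zero` cases.
* §2 `heisMatrix_eq_one_add_single` — `u(x, z) = 1 + xE₀₁ − c(x)E₁₂ + zE₀₂`; **`coe_adelicVal_eq_heisMatrix`** — `π w = u(x(w), z(w))` for `w ∈ N(𝔸_F)`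
  (★ `mat_heisElt` in the chart ★ `coordX ∕ coordY`).
* §3 `exp_eq_one_add_of_mul_self'` (square-zero exponential, restated privately), **`coe_toMixed_adelicVal`** (the archimedean part of `π w` is
  `1 + x_∞E₀₁ − c(x)_∞E₁₂ + z_∞E₀₂`), **`toMixed_adelicVal_eq_three_expGL`** — `(π w)_∞ = expGL(a₁E₀₂) · expGL(a₂E₀₁) · expGL(a₃E₁₂)` with
  `a₁ = (y + ½ x c(x))_∞`, `a₂ = x_∞`, `a₃ = −c(x)_∞` (`x = x(w)`, `y = y(w)`).
* §4 **`inv_mul_expGL_single_mul`** — `κ⁻¹ expGL(aE_ij) κ = expGL(a • Ad(κ⁻¹)E_ij)` (Mathlib `Matrix.exp_units_conj'`); `inv_mul_three_expGL_mul`.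
* §5 **`inv_mul_ofInfinite_mul_ofFinite_mul`** — `(ι∞ κ · ιf κ_f)⁻¹ (ι∞ W · ιf h) (ι∞ κ · ιf κ_f) = ι∞(κ⁻¹Wκ) · ιf(κ_f⁻¹ h κ_f)`;
  **`adelicVal_borel_mul_conj_eq_threeFactor`** — the assembled normal form of `π((bk)⁻¹ u (bk))` for `b ∈ B(𝔸_F)`, `π k = ι∞ κ · ιf κ_f`, `u ∈ N(𝔸_F)`:
  three archimedean one-parameter factors in the directions `Ad(κ⁻¹)E₀₂, Ad(κ⁻¹)E₀₁, Ad(κ⁻¹)E₁₂` with parameters the archimedean parts of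
  `y′ + ½x′c(x′)`, `x′`, `−c(x′)` (`x′ = x(b⁻¹ub)`, `y′ = y(b⁻¹ub)`, ★ `coordX_borel_conj` ∕ `coe_coordY_borel_conj`), times `ιf` of the `κ_f`-conjugate of the
  finite part `h = (π(b⁻¹ub))_f`.  The archimedean BOUNDS on the parameters and the LEVEL of `h` are the business of the sibling file (FILE 2B).

## References
* J. D. Rogawski, *Automorphic Representations of Unitary Groups in Three Variables*, Ann. of Math. Stud. 123 (1990), §1.10, §2.2 [Rogawski1990].
* A. Borel, H. Jacquet, *Automorphic forms and automorphic representations*, Proc. Symp. Pure Math. 33.1 (1979), §4.1 [BorelJacquet1979].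
-/

set_option autoImplicit false

noncomputable section

open Matrix NumberField NumberField.mixedEmbedding IsDedekindDomain Topology
-- `open scoped Classical` is needed to see the Mathlib normed-ring instances on `mixedSpace E` (note H5 of `AdelicGLnGlue`)
open scoped MatrixGroups Classical

namespace Literature.NumberTheory.Automorphic

namespace UnitaryGroup

/-! ## §1 The `3 × 3` identity `(1 + aE₀₂)(1 + bE₀₁)(1 + dE₁₂) = 1 + bE₀₁ + dE₁₂ + (a + bd)E₀₂` -/

section Ring

variable {R : Type*} [Semiring R]

/-- `E₀₂ E₀₁ = 0`, `E₀₂ E₁₂ = 0`, `E₀₁ E₁₂ = E₀₂` and the squares `E₀₂² = E₀₁² = E₁₂² = 0` in `M₃(R)` (with arbitrary entries). [cite: Rogawski1990, §1.10] -/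
theorem single_mul_single_fin_three (a d : R) :
    Matrix.single (0 : Fin 3) (2 : Fin 3) a * Matrix.single (0 : Fin 3) (1 : Fin 3) d = 0 ∧
      Matrix.single (0 : Fin 3) (2 : Fin 3) a * Matrix.single (1 : Fin 3) (2 : Fin 3) d = 0 ∧
      Matrix.single (0 : Fin 3) (1 : Fin 3) a * Matrix.single (1 : Fin 3) (2 : Fin 3) d = Matrix.single 0 2 (a * d) ∧
      Matrix.single (0 : Fin 3) (2 : Fin 3) a * Matrix.single (0 : Fin 3) (2 : Fin 3) d = 0 ∧
      Matrix.single (0 : Fin 3) (1 : Fin 3) a * Matrix.single (0 : Fin 3) (1 : Fin 3) d = 0 ∧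
      Matrix.single (1 : Fin 3) (2 : Fin 3) a * Matrix.single (1 : Fin 3) (2 : Fin 3) d = 0 :=
  ⟨Matrix.single_mul_single_of_ne a 0 2 0 (by decide) d, Matrix.single_mul_single_of_ne a 0 2 1 (by decide) d,
    Matrix.single_mul_single_same a 0 1 2 d, Matrix.single_mul_single_of_ne a 0 2 0 (by decide) d,
    Matrix.single_mul_single_of_ne a 0 1 0 (by decide) d, Matrix.single_mul_single_of_ne a 1 2 1 (by decide) d⟩

/-- `(1 + aE₀₂)(1 + bE₀₁)(1 + dE₁₂) = 1 + bE₀₁ + dE₁₂ + (a + bd)E₀₂` in `M₃(R)`. [cite: Rogawski1990, §1.10] -/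
theorem one_add_single_three_mul (a b d : R) :
    (1 + Matrix.single (0 : Fin 3) (2 : Fin 3) a) * (1 + Matrix.single (0 : Fin 3) (1 : Fin 3) b) * (1 + Matrix.single (1 : Fin 3) (2 : Fin 3) d) =
      1 + Matrix.single 0 1 b + Matrix.single 1 2 d + Matrix.single 0 2 (a + b * d) := by
  obtain ⟨h1, h2, -, -⟩ := single_mul_single_fin_three (R := R) a b
  obtain ⟨-, h4, -, -⟩ := single_mul_single_fin_three (R := R) a d
  obtain ⟨-, -, h6, -⟩ := single_mul_single_fin_three (R := R) b d
  rw [Matrix.single_add]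
  simp only [mul_add, add_mul, one_mul, mul_one, h1, h4, h6, add_zero]
  abel

end Ring

variable {F E : Type} [Field F] [NumberField F] [Field E] [NumberField E] [Algebra F E]
  {c : E ≃ₐ[F] E}

/-! ## §2 `π w = u(x(w), z(w)) = 1 + xE₀₁ − c(x)E₁₂ + zE₀₂` -/

omit [NumberField F] in
/-- `u(x, z) = 1 + xE₀₁ − c(x)E₁₂ + zE₀₂`, `z = y − ½ x c(x)` (★ `heisMatrix`). [cite: Rogawski1990, §1.10] -/
theorem heisMatrix_eq_one_add_single (x y : AdeleRing (𝓞 E) E) :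
    heisMatrix (c := c) x y =
      1 + Matrix.single 0 1 x + Matrix.single 1 2 (-conjAdele F E c x) + Matrix.single 0 2 (heisZ (c := c) x y) := by
  ext i j
  fin_cases i <;> fin_cases j <;> simp [heisMatrix]

/-- **`π w = u(x(w), z(w))`**: the matrix of `w ∈ N(𝔸_F)` in `GL₃(𝔸_E)` is the Heisenberg matrix of its chart coordinates (★ `mat_heisElt`,
★ `heisChart_coord`). [cite: Rogawski1990, §1.10] -/
theorem coe_adelicVal_eq_heisMatrix (hc : c * c = 1) (w : adelicUnipotent F E c 3) :
    ((adelicVal F E c 3 _ (w : (quasiSplit F E c 3).Adelic) : GL (Fin 3) (AdeleRing (𝓞 E) E)) : Matrix (Fin 3) (Fin 3) (AdeleRing (𝓞 E) E)) =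
      heisMatrix (c := c) (coordX w) ((coordY hc w : traceZeroAdele F E c) : AdeleRing (𝓞 E) E) := by
  have h1 : (w : (quasiSplit F E c 3).Adelic) =
      (((heisElt hc (coordX w) (coordY hc w) : unipotentInBorel F E c 3) : borelAdelic F E c 3) : (quasiSplit F E c 3).Adelic) := by
    rw [← coe_heisChart hc (coordX w, coordY hc w), heisChart_coord]
  rw [h1]
  exact mat_heisElt hc _ _

/-- `π w = 1 + xE₀₁ − c(x)E₁₂ + zE₀₂` with `x = x(w)`, `z = z(w) = y(w) − ½ x c(x)`. [cite: Rogawski1990, §1.10] -/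
theorem coe_adelicVal_eq_one_add_single (hc : c * c = 1) (w : adelicUnipotent F E c 3) :
    ((adelicVal F E c 3 _ (w : (quasiSplit F E c 3).Adelic) : GL (Fin 3) (AdeleRing (𝓞 E) E)) : Matrix (Fin 3) (Fin 3) (AdeleRing (𝓞 E) E)) =
      1 + Matrix.single 0 1 (coordX w) + Matrix.single 1 2 (-conjAdele F E c (coordX w)) +
        Matrix.single 0 2 (heisZ (c := c) (coordX w) ((coordY hc w : traceZeroAdele F E c) : AdeleRing (𝓞 E) E)) := by
  rw [coe_adelicVal_eq_heisMatrix hc, heisMatrix_eq_one_add_single]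

/-! ## §3 The archimedean part: `(π w)_∞ = expGL(a₁E₀₂) · expGL(a₂E₀₁) · expGL(a₃E₁₂)` -/

/-- `½ + ½ = 1` for the adèle `halfAdele = 2⁻¹`. [folklore] -/
private theorem halfAdele_add_halfAdele : (halfAdele : AdeleRing (𝓞 E) E) + halfAdele = 1 := by
  rw [halfAdele, ← map_add, ← map_one (algebraMap E (AdeleRing (𝓞 E) E))]
  congr 1
  norm_num

/-- The exponential of a square-zero matrix is `1 + Z` (the series stops; restated from the tree's `Matrix.exp_eq_one_add_of_mul_self` to keep the
imports of this file light). [folklore] -/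
private theorem exp_eq_one_add_of_mul_self' {N : Type*} [Fintype N] [DecidableEq N]
    {A : Type*} [NormedCommRing A] [NormedAlgebra ℝ A] [CompleteSpace A]
    {Z : Matrix N N A} (hZ : Z * Z = 0) : NormedSpace.exp Z = 1 + Z := by
  letI : NormedRing (Matrix N N A) := Matrix.linftyOpNormedRing
  letI : NormedAlgebra ℝ (Matrix N N A) := Matrix.linftyOpNormedAlgebra
  rw [NormedSpace.exp_eq_tsum ℝ]
  change (∑' m : ℕ, ((m.factorial : ℝ)⁻¹) • Z ^ m) = 1 + Z
  have hpow : ∀ m : ℕ, m ∉ Finset.range 2 → Z ^ m = 0 := fun m hm => by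
    rw [Finset.mem_range, not_lt] at hm
    obtain ⟨j, rfl⟩ := Nat.exists_eq_add_of_le hm
    rw [pow_add, pow_two, hZ, zero_mul]
  rw [tsum_eq_sum (s := Finset.range 2) fun m hm => by rw [hpow m hm, smul_zero]]
  simp [Finset.sum_range_succ]

/-- `expGL (single i j a) = 1 + single i j a` as matrices, for the three positions `(0,2), (0,1), (1,2)`. [cite: Rogawski1990, §1.10] -/
theorem coe_expGL_single (a : mixedSpace E) :
    ((expGL (Matrix.single (0 : Fin 3) (2 : Fin 3) a) : GL (Fin 3) (mixedSpace E)) : Matrix (Fin 3) (Fin 3) (mixedSpace E)) = 1 + Matrix.single 0 2 a ∧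
      ((expGL (Matrix.single (0 : Fin 3) (1 : Fin 3) a) : GL (Fin 3) (mixedSpace E)) : Matrix (Fin 3) (Fin 3) (mixedSpace E)) = 1 + Matrix.single 0 1 a ∧
      ((expGL (Matrix.single (1 : Fin 3) (2 : Fin 3) a) : GL (Fin 3) (mixedSpace E)) : Matrix (Fin 3) (Fin 3) (mixedSpace E)) = 1 + Matrix.single 1 2 a := by
  obtain ⟨-, -, -, h02, h01, h12⟩ := single_mul_single_fin_three (R := mixedSpace E) a a
  exact ⟨by rw [coe_expGL]; exact exp_eq_one_add_of_mul_self' h02, by rw [coe_expGL]; exact exp_eq_one_add_of_mul_self' h01,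
    by rw [coe_expGL]; exact exp_eq_one_add_of_mul_self' h12⟩

/-- The archimedean part `g_∞` of `g ∈ GL₃(𝔸_E)` is the entrywise image under `archHom` (definitional). [cite: BorelJacquet1979, §4.1] -/
theorem coe_toMixed_eq_map (g : GL (Fin 3) (AdeleRing (𝓞 E) E)) :
    ((GLn.toMixed 3 E g : GL (Fin 3) (mixedSpace E)) : Matrix (Fin 3) (Fin 3) (mixedSpace E)) =
      (g : Matrix (Fin 3) (Fin 3) (AdeleRing (𝓞 E) E)).map (archHom E) :=
  Matrix.ext fun _ _ => rfl

/-- **The archimedean part of `π w`** (`w ∈ N(𝔸_F)`): `(π w)_∞ = 1 + x_∞E₀₁ − c(x)_∞E₁₂ + z_∞E₀₂`, the archimedean parts read in `mixedSpace E`.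
[cite: BorelJacquet1979, §4.1] -/
theorem coe_toMixed_adelicVal (hc : c * c = 1) (w : adelicUnipotent F E c 3) :
    ((GLn.toMixed 3 E (adelicVal F E c 3 _ (w : (quasiSplit F E c 3).Adelic)) : GL (Fin 3) (mixedSpace E)) : Matrix (Fin 3) (Fin 3) (mixedSpace E)) =
      1 + Matrix.single 0 1 (archHom E (coordX w)) + Matrix.single 1 2 (archHom E (-conjAdele F E c (coordX w))) +
        Matrix.single 0 2 (archHom E (heisZ (c := c) (coordX w) ((coordY hc w : traceZeroAdele F E c) : AdeleRing (𝓞 E) E))) := by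
  rw [coe_toMixed_eq_map, coe_adelicVal_eq_one_add_single hc, Matrix.map_add _ (map_add (archHom E)),
    Matrix.map_add _ (map_add (archHom E)), Matrix.map_add _ (map_add (archHom E)),
    Matrix.map_one (archHom E) (map_zero _) (map_one _), Matrix.map_single, Matrix.map_single, Matrix.map_single]

/-- **`(π w)_∞ = expGL(a₁E₀₂) · expGL(a₂E₀₁) · expGL(a₃E₁₂)`** with `a₁ = (y + ½ x c(x))_∞`, `a₂ = x_∞`, `a₃ = (−c(x))_∞` (`x = x(w)`, `y = y(w)`):
the three elementary unipotent factors of the archimedean Heisenberg element, in the order `(0,2), (0,1), (1,2)`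
(`(1 + aE₀₂)(1 + bE₀₁)(1 + dE₁₂) = 1 + bE₀₁ + dE₁₂ + (a + bd)E₀₂`, `a + bd = z = y − ½ x c(x)`). [cite: Rogawski1990, §1.10] -/
theorem toMixed_adelicVal_eq_three_expGL (hc : c * c = 1) (w : adelicUnipotent F E c 3) :
    GLn.toMixed 3 E (adelicVal F E c 3 _ (w : (quasiSplit F E c 3).Adelic)) =
      expGL (Matrix.single (0 : Fin 3) (2 : Fin 3)
          (archHom E (((coordY hc w : traceZeroAdele F E c) : AdeleRing (𝓞 E) E) + halfAdele * (coordX w * conjAdele F E c (coordX w))))) *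
        expGL (Matrix.single (0 : Fin 3) (1 : Fin 3) (archHom E (coordX w))) *
        expGL (Matrix.single (1 : Fin 3) (2 : Fin 3) (archHom E (-conjAdele F E c (coordX w)))) := by
  refine Units.ext ?_
  rw [Units.val_mul, Units.val_mul, (coe_expGL_single _).1, (coe_expGL_single _).2.1, (coe_expGL_single _).2.2, one_add_single_three_mul,
    coe_toMixed_adelicVal hc]
  -- `(y + ½ x c(x))_∞ + x_∞ · (−c(x))_∞ = (y − ½ x c(x))_∞`
  have key : heisZ (c := c) (coordX w) ((coordY hc w : traceZeroAdele F E c) : AdeleRing (𝓞 E) E) =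
      (((coordY hc w : traceZeroAdele F E c) : AdeleRing (𝓞 E) E) + halfAdele * (coordX w * conjAdele F E c (coordX w))) +
        coordX w * -conjAdele F E c (coordX w) := by
    rw [heisZ]
    linear_combination (-(coordX w * conjAdele F E c (coordX w))) * (halfAdele_add_halfAdele (E := E))
  rw [key, map_add, map_mul]

/-! ## §4 Conjugating the factors by `κ ∈ GL₃(E ⊗ ℝ)`: `κ⁻¹ expGL(aE_ij) κ = expGL(a • Ad(κ⁻¹)E_ij)` -/

/-- **`κ⁻¹ expGL(aE_ij) κ = expGL(a • (κ⁻¹ E_ij κ))`** (Mathlib `Matrix.exp_units_conj'`; `aE_ij = a • E_ij` and scalars commute with `κ`). [folklore] -/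
private theorem inv_mul_expGL_single_mul' (κ : GL (Fin 3) (mixedSpace E)) (i j : Fin 3) (a : mixedSpace E) :
    κ⁻¹ * expGL (Matrix.single i j a) * κ =
      expGL (a • (((κ⁻¹ : GL (Fin 3) (mixedSpace E)) : Matrix (Fin 3) (Fin 3) (mixedSpace E)) * Matrix.single i j (1 : mixedSpace E) *
        ((κ : GL (Fin 3) (mixedSpace E)) : Matrix (Fin 3) (Fin 3) (mixedSpace E)))) := by
  refine Units.ext ?_
  have hs : Matrix.single i j a = a • Matrix.single i j (1 : mixedSpace E) := by
    rw [Matrix.smul_single, smul_eq_mul, mul_one]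
  rw [Units.val_mul, Units.val_mul, coe_expGL, coe_expGL, ← Matrix.smul_mul, ← Matrix.mul_smul, ← hs]
  exact (Matrix.exp_units_conj' κ (Matrix.single i j a)).symm

/-- **`κ⁻¹ expGL(aE_ij) κ = expGL(a • Ad(κ⁻¹)E_ij)`**, `Ad(κ⁻¹)E_ij = κ⁻¹ E_ij κ`. [cite: BorelJacquet1979, §4.1] -/
theorem inv_mul_expGL_single_mul (κ : GL (Fin 3) (mixedSpace E)) (i j : Fin 3) (a : mixedSpace E) :
    κ⁻¹ * expGL (Matrix.single i j a) * κ =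
      expGL (a • (((κ⁻¹ : GL (Fin 3) (mixedSpace E)) : Matrix (Fin 3) (Fin 3) (mixedSpace E)) * Matrix.single i j (1 : mixedSpace E) *
        ((κ : GL (Fin 3) (mixedSpace E)) : Matrix (Fin 3) (Fin 3) (mixedSpace E)))) :=
  inv_mul_expGL_single_mul' κ i j a

/-- Conjugating the three-factor product: `κ⁻¹ (e₁ e₂ e₃) κ = (κ⁻¹e₁κ)(κ⁻¹e₂κ)(κ⁻¹e₃κ)` with each factor rewritten by `inv_mul_expGL_single_mul`. [cite: BorelJacquet1979, §4.1] -/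
theorem inv_mul_three_expGL_mul (κ : GL (Fin 3) (mixedSpace E)) (a₁ a₂ a₃ : mixedSpace E) :
    κ⁻¹ * (expGL (Matrix.single (0 : Fin 3) (2 : Fin 3) a₁) * expGL (Matrix.single (0 : Fin 3) (1 : Fin 3) a₂) *
        expGL (Matrix.single (1 : Fin 3) (2 : Fin 3) a₃)) * κ =
      expGL (a₁ • (((κ⁻¹ : GL (Fin 3) (mixedSpace E)) : Matrix (Fin 3) (Fin 3) (mixedSpace E)) * Matrix.single 0 2 (1 : mixedSpace E) *
          ((κ : GL (Fin 3) (mixedSpace E)) : Matrix (Fin 3) (Fin 3) (mixedSpace E)))) *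
        expGL (a₂ • (((κ⁻¹ : GL (Fin 3) (mixedSpace E)) : Matrix (Fin 3) (Fin 3) (mixedSpace E)) * Matrix.single 0 1 (1 : mixedSpace E) *
          ((κ : GL (Fin 3) (mixedSpace E)) : Matrix (Fin 3) (Fin 3) (mixedSpace E)))) *
        expGL (a₃ • (((κ⁻¹ : GL (Fin 3) (mixedSpace E)) : Matrix (Fin 3) (Fin 3) (mixedSpace E)) * Matrix.single 1 2 (1 : mixedSpace E) *
          ((κ : GL (Fin 3) (mixedSpace E)) : Matrix (Fin 3) (Fin 3) (mixedSpace E)))) := by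
  rw [← inv_mul_expGL_single_mul, ← inv_mul_expGL_single_mul, ← inv_mul_expGL_single_mul]
  group

/-! ## §5 The `∞ × f` splitting and the assembled normal form -/

/-- **`(ι∞ κ · ιf κ_f)⁻¹ (ι∞ W · ιf h) (ι∞ κ · ιf κ_f) = ι∞(κ⁻¹ W κ) · ιf(κ_f⁻¹ h κ_f)`**: `GL₃(𝔸_E) = GL₃(E ⊗ ℝ) × GL₃(𝔸_E^∞)` componentwise
(compare archimedean and finite parts, ★ `GLn.ext_of_fstHom_of_sndHom`). [cite: BorelJacquet1979, §4.1] -/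
theorem inv_mul_ofInfinite_mul_ofFinite_mul (κ W : GL (Fin 3) (mixedSpace E)) (κf h : GL (Fin 3) (FiniteAdeleRing (𝓞 E) E)) :
    (GLn.ofInfinite 3 E κ * GLn.ofFinite 3 E κf)⁻¹ * (GLn.ofInfinite 3 E W * GLn.ofFinite 3 E h) * (GLn.ofInfinite 3 E κ * GLn.ofFinite 3 E κf) =
      GLn.ofInfinite 3 E (κ⁻¹ * W * κ) * GLn.ofFinite 3 E (κf⁻¹ * h * κf) := by
  refine GLn.ext_of_fstHom_of_sndHom ?_ ?_
  · simp only [map_mul, map_inv, GLn.fstHom_ofInfinite, GLn.fstHom_ofFinite, mul_one, inv_one]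
  · simp only [map_mul, map_inv, GLn.sndHom_ofInfinite, GLn.sndHom_ofFinite, one_mul, mul_one, inv_one]

/-- `g = ι∞(g_∞) · ιf(g_f)` for `g = π w` (★ `GLn.ofInfinite_toMixed_mul_ofFinite_sndHom`, recorded in the letters of this file). [cite: BorelJacquet1979, §4.1] -/
theorem adelicVal_eq_ofInfinite_mul_ofFinite (w : (quasiSplit F E c 3).Adelic) :
    adelicVal F E c 3 _ w =
      GLn.ofInfinite 3 E (GLn.toMixed 3 E (adelicVal F E c 3 _ w)) * GLn.ofFinite 3 E (GLn.sndHom 3 E (adelicVal F E c 3 _ w)) :=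
  (GLn.ofInfinite_toMixed_mul_ofFinite_sndHom _).symm

/-- **THE THREE-FACTOR NORMAL FORM (algebraic part).** For `b ∈ B(𝔸_F)`, `k ∈ G(𝔸_F)` with `π k = ι∞ κ · ιf κ_f`, and `u ∈ N(𝔸_F)`, writing `w := b⁻¹ u b ∈ N(𝔸_F)`
(★ `borel_inv_mul_mul_mem_adelicUnipotent`; its coordinates `x′ = x(w)`, `y′ = y(w)` are given by ★ `coordX_borel_conj` ∕ `coe_coordY_borel_conj`):
`π((bk)⁻¹ u (bk)) = ι∞( expGL(a₁ • Ad(κ⁻¹)E₀₂) · expGL(a₂ • Ad(κ⁻¹)E₀₁) · expGL(a₃ • Ad(κ⁻¹)E₁₂) ) · ιf( κ_f⁻¹ (π w)_f κ_f )` with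
`a₁ = (y′ + ½ x′c(x′))_∞`, `a₂ = x′_∞`, `a₃ = (−c(x′))_∞`. [cite: Rogawski1990, §2.2 (p. 13)] -/
theorem adelicVal_borel_mul_conj_eq_threeFactor (hc : c * c = 1) (b : borelAdelic F E c 3) (k : (quasiSplit F E c 3).Adelic)
    (κ : GL (Fin 3) (mixedSpace E)) (κf : GL (Fin 3) (FiniteAdeleRing (𝓞 E) E))
    (hk : adelicVal F E c 3 _ k = GLn.ofInfinite 3 E κ * GLn.ofFinite 3 E κf) (u : adelicUnipotent F E c 3) :
    adelicVal F E c 3 _ (((b : (quasiSplit F E c 3).Adelic) * k)⁻¹ * (u : (quasiSplit F E c 3).Adelic) * ((b : (quasiSplit F E c 3).Adelic) * k)) =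
      GLn.ofInfinite 3 E
          (expGL ((archHom E
              (((coordY hc ⟨(b : (quasiSplit F E c 3).Adelic)⁻¹ * (u : (quasiSplit F E c 3).Adelic) * (b : (quasiSplit F E c 3).Adelic),
                  borel_inv_mul_mul_mem_adelicUnipotent b u⟩ : traceZeroAdele F E c) : AdeleRing (𝓞 E) E) +
                halfAdele * (coordX ⟨(b : (quasiSplit F E c 3).Adelic)⁻¹ * (u : (quasiSplit F E c 3).Adelic) * (b : (quasiSplit F E c 3).Adelic),
                  borel_inv_mul_mul_mem_adelicUnipotent b u⟩ *
                  conjAdele F E c (coordX ⟨(b : (quasiSplit F E c 3).Adelic)⁻¹ * (u : (quasiSplit F E c 3).Adelic) * (b : (quasiSplit F E c 3).Adelic),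
                    borel_inv_mul_mul_mem_adelicUnipotent b u⟩)))) •
              (((κ⁻¹ : GL (Fin 3) (mixedSpace E)) : Matrix (Fin 3) (Fin 3) (mixedSpace E)) * Matrix.single 0 2 (1 : mixedSpace E) *
                ((κ : GL (Fin 3) (mixedSpace E)) : Matrix (Fin 3) (Fin 3) (mixedSpace E)))) *
            expGL ((archHom E
              (coordX ⟨(b : (quasiSplit F E c 3).Adelic)⁻¹ * (u : (quasiSplit F E c 3).Adelic) * (b : (quasiSplit F E c 3).Adelic),
                borel_inv_mul_mul_mem_adelicUnipotent b u⟩)) •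
              (((κ⁻¹ : GL (Fin 3) (mixedSpace E)) : Matrix (Fin 3) (Fin 3) (mixedSpace E)) * Matrix.single 0 1 (1 : mixedSpace E) *
                ((κ : GL (Fin 3) (mixedSpace E)) : Matrix (Fin 3) (Fin 3) (mixedSpace E)))) *
            expGL ((archHom E
              (-conjAdele F E c (coordX ⟨(b : (quasiSplit F E c 3).Adelic)⁻¹ * (u : (quasiSplit F E c 3).Adelic) * (b : (quasiSplit F E c 3).Adelic),
                borel_inv_mul_mul_mem_adelicUnipotent b u⟩))) •
              (((κ⁻¹ : GL (Fin 3) (mixedSpace E)) : Matrix (Fin 3) (Fin 3) (mixedSpace E)) * Matrix.single 1 2 (1 : mixedSpace E) *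
                ((κ : GL (Fin 3) (mixedSpace E)) : Matrix (Fin 3) (Fin 3) (mixedSpace E))))) *
        GLn.ofFinite 3 E (κf⁻¹ *
          GLn.sndHom 3 E (adelicVal F E c 3 _ ((b : (quasiSplit F E c 3).Adelic)⁻¹ * (u : (quasiSplit F E c 3).Adelic) * (b : (quasiSplit F E c 3).Adelic))) * κf) := by
  set w : adelicUnipotent F E c 3 := ⟨(b : (quasiSplit F E c 3).Adelic)⁻¹ * (u : (quasiSplit F E c 3).Adelic) * (b : (quasiSplit F E c 3).Adelic),
    borel_inv_mul_mul_mem_adelicUnipotent b u⟩ with hw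
  have hgrp : ((b : (quasiSplit F E c 3).Adelic) * k)⁻¹ * (u : (quasiSplit F E c 3).Adelic) * ((b : (quasiSplit F E c 3).Adelic) * k) =
      k⁻¹ * (w : (quasiSplit F E c 3).Adelic) * k := by
    rw [hw]
    group
  have h1 := adelicVal_eq_ofInfinite_mul_ofFinite (w : (quasiSplit F E c 3).Adelic)
  rw [toMixed_adelicVal_eq_three_expGL hc w] at h1
  rw [hgrp, map_mul, map_mul, map_inv, hk]
  nth_rw 1 [h1]
  rw [inv_mul_ofInfinite_mul_ofFinite_mul, inv_mul_three_expGL_mul]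

end UnitaryGroup

end Literature.NumberTheory.Automorphic

end
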